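import Summits.MatrixMultiplication.MatrixMultiplication.Theorems.AbelianSTPPCensusTAStatDSound
import Summits.MatrixMultiplication.MatrixMultiplication.Theorems.AbelianSTPPCensusTAStatDDom0
import Summits.MatrixMultiplication.MatrixMultiplication.Theorems.AbelianSTPPCensusTAStatDDom1
import Summits.MatrixMultiplication.MatrixMultiplication.Theorems.AbelianSTPPCensusTAStatDDom2
import Summits.MatrixMultiplication.MatrixMultiplication.Theorems.AbelianSTPPCensusTAStatDDom3
import Summits.MatrixMultiplication.MatrixMultiplication.Theorems.AbelianSTPPCensusTAStatDDom4
import Summits.MatrixMultiplication.MatrixMultiplication.Theorems.AbelianSTPPCensusTAStatDDom5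
import Summits.MatrixMultiplication.MatrixMultiplication.Theorems.AbelianSTPPCensusTAStatDDom6
import Summits.MatrixMultiplication.MatrixMultiplication.Theorems.AbelianSTPPCensusTAStatDDom7
import Summits.MatrixMultiplication.MatrixMultiplication.Theorems.AbelianSTPPCensusTAStatDDom8
import Summits.MatrixMultiplication.MatrixMultiplication.Theorems.AbelianSTPPCensusTAStatDDom9
import Summits.MatrixMultiplication.MatrixMultiplication.Theorems.AbelianSTPPCensusTAStatDCk01
import Summits.MatrixMultiplication.MatrixMultiplication.Theorems.AbelianSTPPCensusTAStatDCk02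
import Summits.MatrixMultiplication.MatrixMultiplication.Theorems.AbelianSTPPCensusTAStatDCk03
import Summits.MatrixMultiplication.MatrixMultiplication.Theorems.AbelianSTPPCensusTAStatDCk04
import Summits.MatrixMultiplication.MatrixMultiplication.Theorems.AbelianSTPPCensusTAStatDCk05
import Summits.MatrixMultiplication.MatrixMultiplication.Theorems.AbelianSTPPCensusTAStatDCk06
import Summits.MatrixMultiplication.MatrixMultiplication.Theorems.AbelianSTPPCensusTAStatDCk07
import Summits.MatrixMultiplication.MatrixMultiplication.Theorems.AbelianSTPPCensusTAStatDCk08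
import Summits.MatrixMultiplication.MatrixMultiplication.Theorems.AbelianSTPPCensusTAStatDCk09
import Summits.MatrixMultiplication.MatrixMultiplication.Theorems.AbelianSTPPCensusTAStatDCk10
import Summits.MatrixMultiplication.MatrixMultiplication.Theorems.AbelianSTPPCensusTAStatDCk11
import Summits.MatrixMultiplication.MatrixMultiplication.Theorems.AbelianSTPPCensusLeafTA6190Closed

/-!
# T_A/6379: no abelian STPP host of order `≤ 6379` beats `τ = 2.371` (fourth range of the static t*-indexed linear certificate: free budget parameter, integer t*-bound, second explicit member)

Cell mm-stpp (rung F-M1, D-0059/D-0061), T_A = the brief's threshold «beat the record exponent `2.371`»: for every finite abelian group `H` with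
`|H| ≤ 6379` and every STPP family `(A_i,B_i,C_i)` in `H`, `Σ_i (|A_i||B_i||C_i|)^{2.371/3} ≤ |H|`.  Stated on `NoAbelianSTPPHostUpTo (2371/1000) 6379`.
Assembly: `|H| ≤ 6190` by `noAbelianSTPPHostUpTo_2371_6190` (theory g12, third range); `6191 … 6379` by `AbelianTECensus.sieveSound`, `u11GSound_holds`,
`TAKnap575.e3Adm_of_isSTPP` and the fourth-range certificate `TAStatD.not_beats_of_cert` fed with the kernel evaluations `TAStatD.mono_ok`, `TAStatD.m2c*`, `TAStatD.dom*`,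
`TAStatD.ck*`; degenerate / one-member families by `AbelianTECensus.noAbelianSTPPHostUpTo_of_two`.  The changes from the third range (`≤ 6190`,
free budget parameter `TP[j] ≤ TB[j]`): the bucket walk stops by the INTEGER bound `t* ≤ max_b b·min(b, ⌊V_l/b²⌋)` (`TAStat2M.tiOK`), and strictly above the
maximal member's own bucket a failing one-member cover is replaced by the exact per-order two-member cover `TAStat2M.cover2` against every shape of the
bucket's complete second-member list (here only `t* ∈ [222, 235]`: the near-cubes `(15,15,15)`, `(15,15,16)`, `(14,16,16)` next to the fat maximal members
`(13,15,19)`, `(14,14,19)`, `(13,16,18)`, `(13,17,17)`, `(14,15,18)`) — seat twins calc/tastat2/tastat3.py, tastat4.py (kit j291146/j291218/j291261/j291524),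
design HOME/mm-stpp-theory/TA-RANGE-D-RECIPE.md.  `6379` is what this family certifies (it fails from `6380` on the own-bucket pair `l = (14,16,17)`); the
registered instrument vQ is alive from `6834` (`TALinWall.vqCensusTA_false_at_6834`).
WHAT THIS IS NOT: no bound on `ω` (rung-leaf class, never summit credit); nothing about orders `≥ 6380`; nothing about `T_E`/`T_D` or non-abelian
hosts; no existence claim.
-/

set_option linter.dupNamespace false
set_option autoImplicit false

namespace Summit.MatrixMultiplication.MatrixMultiplication.Theorems

namespace TAStatD

open ShapeCert (gainOf2371i D)
open TAStatDData (nl nb)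

/-- **The certificate excludes beating.** Under the hypotheses of `sum_gain_le`: `¬ Beats (2371/1000) M`. [original] -/
theorem not_beats_of_cert (hmono : monoOK nl nb = true)
    (hdom : ∀ V, 1 ≤ V → V ≤ 6379 → ∀ x ∈ triplesS V, domX V (gainOf2371i V) x = true)
    (hck : ∀ V, 1 ≤ V → V ≤ 6379 → ∀ x ∈ triplesS V, checkShape V (gainOf2371i V) x = true)
    (hm2 : ∀ V, 1 ≤ V → V ≤ 6379 → ∀ x ∈ triplesS V, m2f (bucketOf (x.1 * x.2.1)) = true → x ∈ m2l (bucketOf (x.1 * x.2.1)))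
    {N M : ℕ} {a b c : Fin N → ℕ} (hN : 2 ≤ N) (hlo : 6191 ≤ M) (hM : M ≤ 6379)
    (hS : SieveAdmissible M a b c) (hG : U11G M a b c) (hE : TAKnap575.E3Adm M a b c) : ¬ Beats (2371 / 1000) M a b c := by
  have hsum := sum_gain_le hmono hdom hck hm2 hN hlo hM hS hG hE
  have hV : ∀ i, a i * b i * c i ≤ 6700 := fun i => by
    have := (hS.1 i).2.2.2; simp only [shapeVol] at this; omega
  unfold Beats
  simp only [shapeVol, not_lt]
  have hle : ∑ i, ((a i * b i * c i : ℕ) : ℝ) ^ ((2371 / 1000 : ℝ) / 3) ≤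
      ∑ i, (gainOf2371i (a i * b i * c i) : ℝ) / 1000000 :=
    Finset.sum_le_sum fun i _ => ShapeCert.rpow_le_gain2371i _ (hV i)
  rw [← Finset.sum_div] at hle
  refine hle.trans ?_
  rw [div_le_iff₀ (by norm_num)]
  have h2 : ((∑ i, gainOf2371i (a i * b i * c i) : ℕ) : ℝ) ≤ ((D * M : ℕ) : ℝ) := by exact_mod_cast hsum
  push_cast at h2
  simpa [D, mul_comm] using h2

/-- every sorted candidate shape of every volume `1 … 6379` is dominated by the table (the `dom*` kernel chunks, tiled) -/
theorem dom_all : ∀ V, 1 ≤ V → V ≤ 6379 → ∀ x ∈ triplesS V, domX V (gainOf2371i V) x = true := by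
  intro V h1 h2
  by_cases c1 : V ≤ 527
  · exact domV_sound _ _ dom1 V (by omega) (by omega)
  by_cases c528 : V ≤ 923
  · exact domV_sound _ _ dom528 V (by omega) (by omega)
  by_cases c924 : V ≤ 1287
  · exact domV_sound _ _ dom924 V (by omega) (by omega)
  by_cases c1288 : V ≤ 1631
  · exact domV_sound _ _ dom1288 V (by omega) (by omega)
  by_cases c1632 : V ≤ 1959
  · exact domV_sound _ _ dom1632 V (by omega) (by omega)
  by_cases c1960 : V ≤ 2279
  · exact domV_sound _ _ dom1960 V (by omega) (by omega)
  by_cases c2280 : V ≤ 2591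
  · exact domV_sound _ _ dom2280 V (by omega) (by omega)
  by_cases c2592 : V ≤ 2891
  · exact domV_sound _ _ dom2592 V (by omega) (by omega)
  by_cases c2892 : V ≤ 3191
  · exact domV_sound _ _ dom2892 V (by omega) (by omega)
  by_cases c3192 : V ≤ 3519
  · exact domV_sound _ _ dom3192 V (by omega) (by omega)
  by_cases c3520 : V ≤ 3839
  · exact domV_sound _ _ dom3520 V (by omega) (by omega)
  by_cases c3840 : V ≤ 4157
  · exact domV_sound _ _ dom3840 V (by omega) (by omega)
  by_cases c4158 : V ≤ 4479
  · exact domV_sound _ _ dom4158 V (by omega) (by omega)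
  by_cases c4480 : V ≤ 4799
  · exact domV_sound _ _ dom4480 V (by omega) (by omega)
  by_cases c4800 : V ≤ 5135
  · exact domV_sound _ _ dom4800 V (by omega) (by omega)
  by_cases c5136 : V ≤ 5499
  · exact domV_sound _ _ dom5136 V (by omega) (by omega)
  by_cases c5500 : V ≤ 5899
  · exact domV_sound _ _ dom5500 V (by omega) (by omega)
  exact domV_sound _ _ dom5900 V (by omega) (by omega)

/-- every sorted candidate shape of every volume `1 … 6379` passes `checkShape` (the `ck*` kernel chunks, tiled) -/
theorem ck_all : ∀ V, 1 ≤ V → V ≤ 6379 → ∀ x ∈ triplesS V, checkShape V (gainOf2371i V) x = true := by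
  intro V h1 h2
  by_cases c1 : V ≤ 399
  · exact checkV_sound _ _ ck1 V (by omega) (by omega)
  by_cases c400 : V ≤ 609
  · exact checkV_sound _ _ ck400 V (by omega) (by omega)
  by_cases c610 : V ≤ 797
  · exact checkV_sound _ _ ck610 V (by omega) (by omega)
  by_cases c798 : V ≤ 971
  · exact checkV_sound _ _ ck798 V (by omega) (by omega)
  by_cases c972 : V ≤ 1131
  · exact checkV_sound _ _ ck972 V (by omega) (by omega)
  by_cases c1132 : V ≤ 1287
  · exact checkV_sound _ _ ck1132 V (by omega) (by omega)
  by_cases c1288 : V ≤ 1434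
  · exact checkV_sound _ _ ck1288 V (by omega) (by omega)
  by_cases c1435 : V ≤ 1579
  · exact checkV_sound _ _ ck1435 V (by omega) (by omega)
  by_cases c1580 : V ≤ 1719
  · exact checkV_sound _ _ ck1580 V (by omega) (by omega)
  by_cases c1720 : V ≤ 1855
  · exact checkV_sound _ _ ck1720 V (by omega) (by omega)
  by_cases c1856 : V ≤ 1991
  · exact checkV_sound _ _ ck1856 V (by omega) (by omega)
  by_cases c1992 : V ≤ 2121
  · exact checkV_sound _ _ ck1992 V (by omega) (by omega)
  by_cases c2122 : V ≤ 2249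
  · exact checkV_sound _ _ ck2122 V (by omega) (by omega)
  by_cases c2250 : V ≤ 2375
  · exact checkV_sound _ _ ck2250 V (by omega) (by omega)
  by_cases c2376 : V ≤ 2497
  · exact checkV_sound _ _ ck2376 V (by omega) (by omega)
  by_cases c2498 : V ≤ 2621
  · exact checkV_sound _ _ ck2498 V (by omega) (by omega)
  by_cases c2622 : V ≤ 2742
  · exact checkV_sound _ _ ck2622 V (by omega) (by omega)
  by_cases c2743 : V ≤ 2859
  · exact checkV_sound _ _ ck2743 V (by omega) (by omega)
  by_cases c2860 : V ≤ 2975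
  · exact checkV_sound _ _ ck2860 V (by omega) (by omega)
  by_cases c2976 : V ≤ 3093
  · exact checkV_sound _ _ ck2976 V (by omega) (by omega)
  by_cases c3094 : V ≤ 3211
  · exact checkV_sound _ _ ck3094 V (by omega) (by omega)
  by_cases c3212 : V ≤ 3347
  · exact checkV_sound _ _ ck3212 V (by omega) (by omega)
  by_cases c3348 : V ≤ 3478
  · exact checkV_sound _ _ ck3348 V (by omega) (by omega)
  by_cases c3479 : V ≤ 3607
  · exact checkV_sound _ _ ck3479 V (by omega) (by omega)
  by_cases c3608 : V ≤ 3739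
  · exact checkV_sound _ _ ck3608 V (by omega) (by omega)
  by_cases c3740 : V ≤ 3867
  · exact checkV_sound _ _ ck3740 V (by omega) (by omega)
  by_cases c3868 : V ≤ 3995
  · exact checkV_sound _ _ ck3868 V (by omega) (by omega)
  by_cases c3996 : V ≤ 4119
  · exact checkV_sound _ _ ck3996 V (by omega) (by omega)
  by_cases c4120 : V ≤ 4241
  · exact checkV_sound _ _ ck4120 V (by omega) (by omega)
  by_cases c4242 : V ≤ 4375
  · exact checkV_sound _ _ ck4242 V (by omega) (by omega)
  by_cases c4376 : V ≤ 4511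
  · exact checkV_sound _ _ ck4376 V (by omega) (by omega)
  by_cases c4512 : V ≤ 4643
  · exact checkV_sound _ _ ck4512 V (by omega) (by omega)
  by_cases c4644 : V ≤ 4775
  · exact checkV_sound _ _ ck4644 V (by omega) (by omega)
  by_cases c4776 : V ≤ 4913
  · exact checkV_sound _ _ ck4776 V (by omega) (by omega)
  by_cases c4914 : V ≤ 5047
  · exact checkV_sound _ _ ck4914 V (by omega) (by omega)
  by_cases c5048 : V ≤ 5197
  · exact checkV_sound _ _ ck5048 V (by omega) (by omega)
  by_cases c5198 : V ≤ 5351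
  · exact checkV_sound _ _ ck5198 V (by omega) (by omega)
  by_cases c5352 : V ≤ 5511
  · exact checkV_sound _ _ ck5352 V (by omega) (by omega)
  by_cases c5512 : V ≤ 5687
  · exact checkV_sound _ _ ck5512 V (by omega) (by omega)
  by_cases c5688 : V ≤ 5881
  · exact checkV_sound _ _ ck5688 V (by omega) (by omega)
  by_cases c5882 : V ≤ 6155
  · exact checkV_sound _ _ ck5882 V (by omega) (by omega)
  exact checkV_sound _ _ ck6156 V (by omega) (by omega)

/-- the second-member lists are complete (the `m2c*` kernel chunks, tiled) -/
theorem m2_all : ∀ V, 1 ≤ V → V ≤ 6379 → ∀ x ∈ triplesS V, m2f (bucketOf (x.1 * x.2.1)) = true → x ∈ m2l (bucketOf (x.1 * x.2.1)) := by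
  intro V h1 h2
  by_cases c1 : V ≤ 527
  · exact m2V_sound _ _ m2c1 V (by omega) (by omega)
  by_cases c528 : V ≤ 923
  · exact m2V_sound _ _ m2c528 V (by omega) (by omega)
  by_cases c924 : V ≤ 1287
  · exact m2V_sound _ _ m2c924 V (by omega) (by omega)
  by_cases c1288 : V ≤ 1631
  · exact m2V_sound _ _ m2c1288 V (by omega) (by omega)
  by_cases c1632 : V ≤ 1959
  · exact m2V_sound _ _ m2c1632 V (by omega) (by omega)
  by_cases c1960 : V ≤ 2279
  · exact m2V_sound _ _ m2c1960 V (by omega) (by omega)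
  by_cases c2280 : V ≤ 2591
  · exact m2V_sound _ _ m2c2280 V (by omega) (by omega)
  by_cases c2592 : V ≤ 2891
  · exact m2V_sound _ _ m2c2592 V (by omega) (by omega)
  by_cases c2892 : V ≤ 3191
  · exact m2V_sound _ _ m2c2892 V (by omega) (by omega)
  by_cases c3192 : V ≤ 3519
  · exact m2V_sound _ _ m2c3192 V (by omega) (by omega)
  by_cases c3520 : V ≤ 3839
  · exact m2V_sound _ _ m2c3520 V (by omega) (by omega)
  by_cases c3840 : V ≤ 4157
  · exact m2V_sound _ _ m2c3840 V (by omega) (by omega)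
  by_cases c4158 : V ≤ 4479
  · exact m2V_sound _ _ m2c4158 V (by omega) (by omega)
  by_cases c4480 : V ≤ 4799
  · exact m2V_sound _ _ m2c4480 V (by omega) (by omega)
  by_cases c4800 : V ≤ 5135
  · exact m2V_sound _ _ m2c4800 V (by omega) (by omega)
  by_cases c5136 : V ≤ 5499
  · exact m2V_sound _ _ m2c5136 V (by omega) (by omega)
  by_cases c5500 : V ≤ 5899
  · exact m2V_sound _ _ m2c5500 V (by omega) (by omega)
  exact m2V_sound _ _ m2c5900 V (by omega) (by omega)

/-- **T_A arithmetic exclusion, orders `6191 … 6379`.** No shape list with at least two members that is `SieveAdmissible M`, `U11G M` and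
`TAKnap575.E3Adm M` beats `τ = 2371/1000` at an order `6191 ≤ M ≤ 6379`. [original] -/
theorem not_beats_2371 (N M : ℕ) (a b c : Fin N → ℕ) (hN : 2 ≤ N) (h1 : 6191 ≤ M) (h2 : M ≤ 6379)
    (hS : SieveAdmissible M a b c) (hG : U11G M a b c) (hE : TAKnap575.E3Adm M a b c) : ¬ Beats (2371 / 1000) M a b c :=
  not_beats_of_cert mono_ok dom_all ck_all m2_all hN h1 h2 hS hG hE

end TAStatD

/-- **T_A/6379.** No abelian STPP host of order `≤ 6379` beats the record exponent `2.371`: `Σ_i (|A_i||B_i||C_i|)^{2.371/3} ≤ |H|` for every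
STPP family in every finite abelian group `H` with `|H| ≤ 6379`.  Orders `≤ 6190`: `noAbelianSTPPHostUpTo_2371_6190`; orders `6191 … 6379`:
`AbelianTECensus.sieveSound`, `u11GSound_holds`, `TAKnap575.e3Adm_of_isSTPP` and `TAStatD.not_beats_2371`.
WHAT THIS IS NOT: no bound on `ω`; rung-leaf class; nothing about orders `≥ 6380`, the `5/2` lists, or non-abelian hosts. [original] -/
theorem noAbelianSTPPHostUpTo_2371_6379 : NoAbelianSTPPHostUpTo (2371 / 1000) 6379 := by
  classical
  refine AbelianTECensus.noAbelianSTPPHostUpTo_of_two (τ := 2371 / 1000) (by norm_num) (by norm_num) ?_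
  intro H _ _ hM N A B C hS hne hN
  by_cases h6190 : Fintype.card H ≤ 6190
  · exact noAbelianSTPPHostUpTo_2371_6190 H h6190 N A B C hS
  · have hadm := AbelianTECensus.sieveSound H N A B C hS hne
    have hG := u11GSound_holds H N A B C hS hne
    have he3 := TAKnap575.e3Adm_of_isSTPP hS hne
    have h := TAStatD.not_beats_2371 N (Fintype.card H) _ _ _ hN (by omega) hM hadm hG he3
    unfold Beats at h
    rw [not_lt] at h
    simpa [shapeVol] using h

end Summit.MatrixMultiplication.MatrixMultiplication.Theorems
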